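import Summits.Ventures.Crystal3D.Bulk.HullRotSysEuler
import Summits.Ventures.Crystal3D.Bulk.GapHullRotation
import Summits.Ventures.Crystal3D.Bulk.RotSysCorners
import Literature.Geometry.DiscreteGeometry.SphericalExcessMonotone
import Literature.Geometry.DiscreteGeometry.KissingNodeDegree
import HarnessLib

/-!
# The hull rotation system WEIGHTED by the fan angles: every full face (fan triangle) has angle
# sum `≥ π`, every vertex weighs exactly `2π` (geometric input of P-L3(b) L1,
# `phase2/LEAN-FACES-DESIGN.md` §5.6 (i))

HONEST FRAMING. Part of the venture `Summits/Ventures/Crystal3D` (cell `pub-crystal3d`, phase 2;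
seat p3), generic and configuration-free (`X` any finite set of unit vectors of `ℝ³` with
`0 ∈ interior (conv X)`); nothing here mentions GAP(1.26). The hull rotation system
`(rot, inv)` on `↥(hullDarts X)` (`Bulk/HullRotSys*.lean`) is given the weight

* `fanAngle X (y, a) = ∠(perpTo y a, perpTo y (succV X y a))` — the angle AT `y` of the fan
  triangle on the dart `(y, a)` (tangent angle between the arcs `y → a` and `y → succV y a`),
  `dartWeight X` its restriction to the dart type;

and the two hypotheses of the combinatorial Gauss–Bonnet theorem (`Bulk/RotSysGaussBonnet.lean`)
are verified:

* **`excess_univ_nonneg`** — every face of the full system (a fan triangle `{y, a, b}`) has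
  corner sum `∠_a + ∠_b + ∠_y = π + sphExcess a y b ≥ π` (Literature `sphExcess_nonneg`,
  Girard: the excess is the area);
* **`cornerAt_singleton_eq_two_pi`** — the fan angles around a vertex sum to EXACTLY `2π`:
  by `cos_angle_perpTo_eq_cos_azimuth_sub` each fan angle is the azimuth gap of two cyclically
  consecutive fan neighbours (`angle_nb_succ_eq_liftAz_sub`, gaps `< π` by
  `Bulk/HullRotSysAzimuth.lean`), and the lifted azimuth `liftAz` telescopes once around
  (`liftAz_add_d`).

Also: `face_univ_eq` (the full face of a dart is `{d, φ d, φ² d}`), `phi_univ_pow_three`.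
-/

noncomputable section

namespace Summit.Ventures.Crystal3D

namespace HullRotSys

open Literature.Geometry.DiscreteGeometry Finset Real InnerProductGeometry Equiv

variable {X : Finset (EuclideanSpace ℝ (Fin 3))}

/-! ## The fan-angle weight -/

/-- **The fan angle of a dart** `(y, a)`: the tangent angle at `y` between the arc to `a` and the
arc to the oriented successor `succV X y a` — the angle at `y` of the fan triangle on the dart. -/
def fanAngle (X : Finset (EuclideanSpace ℝ (Fin 3)))
    (p : EuclideanSpace ℝ (Fin 3) × EuclideanSpace ℝ (Fin 3)) : ℝ :=
  angle (perpTo p.1 p.2) (perpTo p.1 (succV X p.1 p.2))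

/-- The fan angle as a weight on the dart type of the hull rotation system. -/
def dartWeight (X : Finset (EuclideanSpace ℝ (Fin 3))) (d : ↥(hullDarts X)) : ℝ :=
  fanAngle X d.1

/-- Unfolding `dartWeight`. -/
theorem dartWeight_apply (d : ↥(hullDarts X)) :
    dartWeight X d = angle (perpTo d.1.1 d.1.2) (perpTo d.1.1 (succV X d.1.1 d.1.2)) := rfl

/-! ## The angle between two tangent projections is the azimuth difference -/

section Azimuth

variable {y : EuclideanSpace ℝ (Fin 3)} {hy : ‖y‖ = 1}

/-- For a unit vector `u`, `‖perpTo y u‖ = trad y u = √(1 − ⟪y, u⟫²)`. -/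
theorem norm_perpTo_eq_trad (hy1 : ‖y‖ = 1) {u : EuclideanSpace ℝ (Fin 3)} (hu : ‖u‖ = 1) :
    ‖perpTo y u‖ = trad y u := by
  unfold trad
  rw [← norm_perpTo_sq_of_norm_eq_one hy1 hu, Real.sqrt_sq (norm_nonneg _)]

/-- **Spherical law of cosines in tangent polar coordinates**: for unit vectors `u, w`,
`⟪u, w⟫ − ⟪y, u⟫⟪y, w⟫ = trad y u · trad y w · cos (θ_w − θ_u)` with `θ = azimuth y hy`. -/
theorem inner_sub_eq_trad_mul_cos {u w : EuclideanSpace ℝ (Fin 3)}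
    (hu : ‖u‖ = 1) (hw : ‖w‖ = 1) :
    inner ℝ u w - inner ℝ y u * inner ℝ y w =
      trad y u * trad y w * Real.cos (azimuth y hy w - azimuth y hy u) := by
  obtain ⟨hu0, hu1⟩ := polarRep_azimuth (y := y) (hy := hy) hu
  obtain ⟨hw0, hw1⟩ := polarRep_azimuth (y := y) (hy := hy) hw
  rw [inner_eq_sum_three (tangentFrame y hy) u w, tangentFrame_two, hu0, hu1, hw0, hw1,
    Real.cos_sub]
  ring

/-- **The tangent angle is the azimuth difference up to sign and `2π`**: for fan neighbours
`u, w` of `y`, `cos ∠(perpTo y u, perpTo y w) = cos (θ_w − θ_u)`. -/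
theorem cos_angle_perpTo_eq_cos_azimuth_sub (hX1 : ∀ y ∈ X, ‖y‖ = 1)
    {u w : EuclideanSpace ℝ (Fin 3)} (hu : u ∈ fanNbrs X y) (hw : w ∈ fanNbrs X y) :
    Real.cos (angle (perpTo y u) (perpTo y w)) =
      Real.cos (azimuth y hy w - azimuth y hy u) := by
  have hu1 := norm_eq_one_of_mem_fanNbrs hX1 hu
  have hw1 := norm_eq_one_of_mem_fanNbrs hX1 hw
  have hru := trad_pos_of_mem_fanNbrs hX1 hu
  have hrw := trad_pos_of_mem_fanNbrs hX1 hw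
  have h := cos_angle_perpTo_mul hy u w
  rw [norm_perpTo_eq_trad hy hu1, norm_perpTo_eq_trad hy hw1,
    inner_sub_eq_trad_mul_cos (hy := hy) hu1 hw1] at h
  have hpos : 0 < trad y u * trad y w := mul_pos hru hrw
  have : (Real.cos (angle (perpTo y u) (perpTo y w)) -
      Real.cos (azimuth y hy w - azimuth y hy u)) * (trad y u * trad y w) = 0 := by
    linarith
  rcases mul_eq_zero.1 this with h1 | h1
  · linarith
  · exact absurd h1 hpos.ne'

/-- **The lifted azimuth** along an azimuth enumeration `E` of the fan neighbours of `y`: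
`Θ q = θ(nb q) + 2π · ⌊q / d⌋` — strictly increasing on `ℕ`, with `Θ (q + d) = Θ q + 2π`. -/
def liftAz (E : NbrEnum X y hy) (q : ℕ) : ℝ :=
  azimuth y hy (E.nb q) + 2 * π * ((q / E.d : ℕ) : ℝ)

/-- On the first period the lifted azimuth is the azimuth. -/
theorem liftAz_of_lt (E : NbrEnum X y hy) {q : ℕ} (hq : q < E.d) :
    liftAz E q = azimuth y hy (E.nb q) := by
  unfold liftAz
  rw [Nat.div_eq_of_lt hq]
  push_cast
  ring

/-- One period adds a full turn: `Θ (q + d) = Θ q + 2π`. -/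
theorem liftAz_add_d (E : NbrEnum X y hy) (q : ℕ) : liftAz E (q + E.d) = liftAz E q + 2 * π := by
  unfold liftAz
  rw [E.periodic, Nat.add_div_right q E.d_pos]
  push_cast
  ring

/-- **Each fan angle between consecutive neighbours is the lifted-azimuth gap**:
`∠(perpTo y (nb q), perpTo y (nb (q+1))) = Θ (q+1) − Θ q` (the gap is `< π` by
`azimuth_gap_lt_pi` / `azimuth_wrap_gap_lt_pi`, so the unoriented angle IS the gap). -/
theorem angle_nb_succ_eq_liftAz_sub (hX1 : ∀ y ∈ X, ‖y‖ = 1)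
    (h0 : (0 : EuclideanSpace ℝ (Fin 3)) ∈ interior (convexHull ℝ (X : Set _)))
    (E : NbrEnum X y hy) (q : ℕ) :
    angle (perpTo y (E.nb q)) (perpTo y (E.nb (q + 1))) = liftAz E (q + 1) - liftAz E q := by
  have hd := E.d_pos
  set r := q % E.d with hr
  have hrd : r < E.d := Nat.mod_lt q hd
  have hqr : E.nb q = E.nb r := by rw [hr, E.nb_mod]
  have hdecomp : q = r + E.d * (q / E.d) := by
    have := Nat.div_add_mod q E.d
    rw [← hr] at this
    linarith
  have hcos := cos_angle_perpTo_eq_cos_azimuth_sub (hy := hy) hX1 (E.mem q) (E.mem (q + 1))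
  -- the candidate value `δ` of the gap, in the two cases
  by_cases hwrap : r + 1 < E.d
  · -- interior gap
    have hmod : (q + 1) % E.d = r + 1 := by
      rw [hdecomp, show r + E.d * (q / E.d) + 1 = (r + 1) + E.d * (q / E.d) by ring,
        Nat.add_mul_mod_self_left, Nat.mod_eq_of_lt hwrap]
    have hdiv : (q + 1) / E.d = q / E.d := by
      conv_lhs => rw [hdecomp, show r + E.d * (q / E.d) + 1 = (r + 1) + E.d * (q / E.d) by ring,
        Nat.add_mul_div_left _ _ hd, Nat.div_eq_of_lt hwrap, zero_add]
    have hq1 : E.nb (q + 1) = E.nb (r + 1) := by rw [← E.nb_mod (q + 1), hmod]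
    have hδ : liftAz E (q + 1) - liftAz E q =
        azimuth y hy (E.nb (r + 1)) - azimuth y hy (E.nb r) := by
      unfold liftAz; rw [hdiv, hq1, hqr]; ring
    have hδpos : 0 < azimuth y hy (E.nb (r + 1)) - azimuth y hy (E.nb r) := by
      linarith [E.mono r (r + 1) (Nat.lt_succ_self r) hwrap]
    have hδlt := azimuth_gap_lt_pi hX1 h0 E hwrap
    rw [hδ, hq1, hqr]
    rw [hq1, hqr] at hcos
    exact Real.injOn_cos ⟨angle_nonneg _ _, angle_le_pi _ _⟩ ⟨hδpos.le, hδlt.le⟩ hcos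
  · -- wrap-around gap
    have hr1 : r + 1 = E.d := by omega
    have hmod : (q + 1) % E.d = 0 := by
      rw [hdecomp, show r + E.d * (q / E.d) + 1 = (r + 1) + E.d * (q / E.d) by ring,
        Nat.add_mul_mod_self_left, hr1, Nat.mod_self]
    have hdiv : (q + 1) / E.d = q / E.d + 1 := by
      conv_lhs => rw [hdecomp, show r + E.d * (q / E.d) + 1 = E.d * (q / E.d + 1) by
        rw [← hr1]; ring, Nat.mul_div_cancel_left _ hd]
    have hq1 : E.nb (q + 1) = E.nb 0 := by rw [← E.nb_mod (q + 1), hmod]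
    have hrr : r = E.d - 1 := by omega
    have hδ : liftAz E (q + 1) - liftAz E q =
        azimuth y hy (E.nb 0) + 2 * π - azimuth y hy (E.nb (E.d - 1)) := by
      unfold liftAz; rw [hdiv, hq1, hqr, hrr]; push_cast; ring
    have hδpos : 0 < azimuth y hy (E.nb 0) + 2 * π - azimuth y hy (E.nb (E.d - 1)) := by
      linarith [neg_pi_lt_azimuth y hy (E.nb 0), azimuth_le_pi y hy (E.nb (E.d - 1))]
    have hδlt := azimuth_wrap_gap_lt_pi hX1 h0 E
    rw [hδ, hq1, hqr, hrr]
    rw [hq1, hqr, hrr] at hcos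
    have hcos' : Real.cos (angle (perpTo y (E.nb (E.d - 1))) (perpTo y (E.nb 0))) =
        Real.cos (azimuth y hy (E.nb 0) + 2 * π - azimuth y hy (E.nb (E.d - 1))) := by
      rw [hcos, show azimuth y hy (E.nb 0) + 2 * π - azimuth y hy (E.nb (E.d - 1)) =
        azimuth y hy (E.nb 0) - azimuth y hy (E.nb (E.d - 1)) + 2 * π by ring, Real.cos_add_two_pi]
    exact Real.injOn_cos ⟨angle_nonneg _ _, angle_le_pi _ _⟩ ⟨hδpos.le, hδlt.le⟩ hcos'

/-- Telescoping: `Σ_{t < n} ∠(nb (K+t), nb (K+t+1)) = Θ (K + n) − Θ K`. -/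
theorem sum_angle_nb_eq_liftAz_sub (hX1 : ∀ y ∈ X, ‖y‖ = 1)
    (h0 : (0 : EuclideanSpace ℝ (Fin 3)) ∈ interior (convexHull ℝ (X : Set _)))
    (E : NbrEnum X y hy) (K n : ℕ) :
    ∑ t ∈ range n, angle (perpTo y (E.nb (K + t))) (perpTo y (E.nb (K + t + 1))) =
      liftAz E (K + n) - liftAz E K := by
  have h := Finset.sum_range_sub (fun t => liftAz E (K + t)) n
  simp only [Nat.add_zero] at h
  rw [← h]
  refine Finset.sum_congr rfl fun t _ => ?_
  rw [angle_nb_succ_eq_liftAz_sub hX1 h0 E (K + t), Nat.add_assoc]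

end Azimuth

/-! ## Every vertex weighs exactly `2π` -/

section Vertex

variable {hX1 : ∀ y ∈ X, ‖y‖ = 1}
  {h0 : (0 : EuclideanSpace ℝ (Fin 3)) ∈ interior (convexHull ℝ (X : Set _))}

/-- **The fan angles around a vertex sum to `2π`**: for every dart `z`, the corner of `z` in the
one-dart map `{z}` — the total weight of its vertex — is `2π`. -/
theorem cornerAt_singleton_eq_two_pi (z : ↥(hullDarts X)) :
    RotSys.cornerAt (rot hX1 h0) (dartWeight X) {z} z = 2 * π := by
  obtain ⟨⟨y, a⟩, hz⟩ := z
  have hyX : y ∈ X := fst_mem_of_mem_hullDarts hX1 hz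
  have hy : ‖y‖ = 1 := hX1 y hyX
  have ha : a ∈ fanNbrs X y := mk_mem_hullDarts_iff.1 hz
  obtain ⟨E⟩ := nonempty_nbrEnum hX1 hy ⟨a, ha⟩
  obtain ⟨K, hK, hKa⟩ := E.surj a ha
  have hd := E.d_pos
  -- iterates of the rotation and the first-return time `d`
  have hne : ∀ m, 0 < m → m < E.d → E.nb (K + m) ≠ E.nb K := fun m hm0 hm =>
    (E.nb_ne_nb_add (k := K) hm0 hm).symm
  rcases lt_or_gt_of_ne (orient3_orthonormalBasis_ne_zero (tangentFrame y hy)) with hneg | hpos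
  · -- left-handed frame: the rotation walks the enumeration backwards
    have hit : ∀ m, m ≤ K + E.d → ((rot hX1 h0 ^ m) ⟨(y, a), hz⟩).1 = (y, E.nb (K + E.d - m)) := by
      intro m hm
      rw [rot_pow_apply_val]
      change (hullSucc X)^[m] (y, a) = _
      rw [← hKa, ← E.periodic K]
      exact iterate_hullSucc_nb_of_det_neg hX1 h0 E hneg hm
    have hret : RotSys.retTime (rot hX1 h0) {⟨(y, a), hz⟩} ⟨(y, a), hz⟩ = E.d := by
      refine RotSys.retTime_eq_of_first_return _ (mem_singleton_self _) hd ?_ ?_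
      · rw [mem_singleton]; apply Subtype.ext
        rw [hit E.d (by omega), show K + E.d - E.d = K by omega, hKa]
      · intro m hm0 hm hmem
        rw [mem_singleton] at hmem
        have := congrArg (fun d : ↥(hullDarts X) => d.1.2) hmem
        simp only at this
        rw [hit m (by omega)] at this
        simp only at this
        rw [← hKa, show K + E.d - m = K + (E.d - m) by omega] at this
        exact (E.nb_ne_nb_add (k := K) (by omega) (by omega)) this.symm
    unfold RotSys.cornerAt
    rw [hret]
    have hterm : ∀ t ∈ range E.d, dartWeight X ((rot hX1 h0 ^ t) ⟨(y, a), hz⟩) =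
        liftAz E (K + (E.d - 1 - t) + 1) - liftAz E (K + (E.d - 1 - t)) := by
      intro t ht
      rw [mem_range] at ht
      rw [dartWeight_apply, hit t (by omega)]
      simp only
      rw [show K + E.d - t = (K + (E.d - 1 - t)) + 1 by omega,
        succV_nb_of_det_neg hX1 h0 E hneg, angle_comm,
        angle_nb_succ_eq_liftAz_sub hX1 h0 E]
    rw [Finset.sum_congr rfl hterm, Finset.sum_range_reflect (fun t =>
      liftAz E (K + t + 1) - liftAz E (K + t)) E.d]
    have h := Finset.sum_range_sub (fun t => liftAz E (K + t)) E.d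
    simp only [Nat.add_zero] at h
    have h' : ∑ t ∈ range E.d, (liftAz E (K + t + 1) - liftAz E (K + t)) =
        liftAz E (K + E.d) - liftAz E K := by
      rw [← h]
      exact Finset.sum_congr rfl fun t _ => by rw [Nat.add_assoc]
    rw [h', liftAz_add_d]; ring
  · -- right-handed frame: the rotation walks the enumeration forwards
    have hit : ∀ m, ((rot hX1 h0 ^ m) ⟨(y, a), hz⟩).1 = (y, E.nb (K + m)) := by
      intro m
      rw [rot_pow_apply_val]
      change (hullSucc X)^[m] (y, a) = _
      rw [← hKa]
      exact iterate_hullSucc_nb_of_det_pos hX1 h0 E hpos m K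
    have hret : RotSys.retTime (rot hX1 h0) {⟨(y, a), hz⟩} ⟨(y, a), hz⟩ = E.d := by
      refine RotSys.retTime_eq_of_first_return _ (mem_singleton_self _) hd ?_ ?_
      · rw [mem_singleton]; apply Subtype.ext
        rw [hit, E.periodic, hKa]
      · intro m hm0 hm hmem
        rw [mem_singleton] at hmem
        have := congrArg (fun d : ↥(hullDarts X) => d.1.2) hmem
        simp only at this
        rw [hit m] at this
        simp only at this
        rw [← hKa] at this
        exact hne m hm0 hm this
    unfold RotSys.cornerAt
    rw [hret]
    have hterm : ∀ t ∈ range E.d, dartWeight X ((rot hX1 h0 ^ t) ⟨(y, a), hz⟩) =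
        angle (perpTo y (E.nb (K + t))) (perpTo y (E.nb (K + t + 1))) := by
      intro t _
      rw [dartWeight_apply, hit t]
      simp only
      rw [succV_nb_of_det_pos hX1 h0 E hpos]
    rw [Finset.sum_congr rfl hterm, sum_angle_nb_eq_liftAz_sub hX1 h0 E, liftAz_add_d]
    ring

/-- In particular every vertex weighs at most `2π`. -/
theorem cornerAt_singleton_le_two_pi (z : ↥(hullDarts X)) :
    RotSys.cornerAt (rot hX1 h0) (dartWeight X) {z} z ≤ 2 * π :=
  (cornerAt_singleton_eq_two_pi z).le

end Vertex

/-! ## Every full face (fan triangle) has angle sum `≥ π` -/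

section Face

open scoped Classical

variable {hX1 : ∀ y ∈ X, ‖y‖ = 1}
  {h0 : (0 : EuclideanSpace ℝ (Fin 3)) ∈ interior (convexHull ℝ (X : Set _))}

/-- `φ³ = 1` on the full hull rotation system. -/
theorem phi_univ_pow_three (d : ↥(hullDarts X)) :
    (RotSys.phi (rot hX1 h0) (inv X) univ ^ 3) d = d := by
  apply Subtype.ext
  rw [phi_univ_pow_apply]
  exact hullFace_hullFace_hullFace hX1 h0 d.2

/-- **The full face of a dart is `{d, φ d, φ² d}`.** -/
theorem face_univ_eq (d : ↥(hullDarts X)) :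
    RotSys.face (rot hX1 h0) (inv X) univ d =
      {d, RotSys.phi (rot hX1 h0) (inv X) univ d,
        (RotSys.phi (rot hX1 h0) (inv X) univ ^ 2) d} := by
  set φ := RotSys.phi (rot hX1 h0) (inv X) univ with hφ
  ext q
  rw [RotSys.mem_face, mem_insert, mem_insert, mem_singleton]
  constructor
  · rintro ⟨-, hc⟩
    rw [sameCycle_phi_iff] at hc
    rcases eq_or_eq_or_eq_of_faceTri_eq hX1 h0 d.2 q.2 hc.symm with h1 | h1 | h1
    · exact Or.inl (Subtype.ext h1)
    · right; left; apply Subtype.ext; rw [h1, phi_univ_apply]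
    · right; right; apply Subtype.ext; rw [h1, phi_univ_pow_apply]; rfl
  · rintro (rfl | rfl | rfl)
    · exact ⟨mem_univ _, Perm.SameCycle.refl _ _⟩
    · exact ⟨mem_univ _, ⟨1, by rw [zpow_one]⟩⟩
    · exact ⟨mem_univ _, ⟨2, by rw [show (2 : ℤ) = ((2 : ℕ) : ℤ) by norm_num, zpow_natCast]⟩⟩

/-- **The corner sum of a full face is the angle sum of its fan triangle, `≥ π`** (Girard /
Literature `sphExcess_nonneg`): every face of the full weighted hull rotation system has
nonnegative excess. -/
theorem excess_univ_nonneg (d : ↥(hullDarts X)) :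
    0 ≤ RotSys.excess (rot hX1 h0) (inv X) (dartWeight X) univ d := by
  obtain ⟨⟨y, a⟩, hd⟩ := d
  set φ := RotSys.phi (rot hX1 h0) (inv X) univ with hφ
  set x : ↥(hullDarts X) := ⟨(y, a), hd⟩ with hx
  -- the triangle `{a, y, b}` on the reversed dart, `b = succV X a y`
  have hay : (a, y) ∈ hullDarts X := swap_mem_hullDarts hd
  have hP := isPosThird_succV hX1 h0 hay
  set b := succV X a y with hb
  have hba : (b, a) ∈ hullDarts X := mk_mem_hullDarts hP.1 (by simp) (by simp) (Ne.symm hP.ne₁₃)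
  have hyb : (y, b) ∈ hullDarts X := mk_mem_hullDarts hP.1 (by simp) (by simp) hP.ne₂₃
  have hsba : succV X b a = y := (succV_eq_iff hX1 h0 hba).2 hP.cyclic.cyclic
  have hsyb : succV X y b = a := (succV_eq_iff hX1 h0 hyb).2 hP.cyclic
  -- the three darts of the face and their weights after `inv`
  have h1 : (φ x).1 = (a, b) := by rw [hφ, phi_univ_apply]; rfl
  have h2 : ((φ ^ 2) x).1 = (b, y) := by
    rw [hφ, phi_univ_pow_apply]
    change hullFace X (hullFace X (y, a)) = (b, y)
    rw [hullFace_hullFace hX1 h0 hd]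
  have hw0 : dartWeight X (inv X x) = angle (perpTo a y) (perpTo a b) := by
    rw [dartWeight_apply, inv_apply_val]; rfl
  have hw1 : dartWeight X (inv X (φ x)) = angle (perpTo b a) (perpTo b y) := by
    rw [dartWeight_apply, inv_apply_val, h1]
    change angle (perpTo b a) (perpTo b (succV X b a)) = _
    rw [hsba]
  have hw2 : dartWeight X (inv X ((φ ^ 2) x)) = angle (perpTo y b) (perpTo y a) := by
    rw [dartWeight_apply, inv_apply_val, h2]
    change angle (perpTo y b) (perpTo y (succV X y b)) = _
    rw [hsyb]
  -- distinctness of the three darts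
  have n01 : x ≠ φ x := fun e => hullFace_ne_self hd (by
    have := congrArg Subtype.val e; rw [h1] at this; exact this.symm)
  have n02 : x ≠ (φ ^ 2) x := fun e => hullFace_hullFace_ne_self hX1 h0 hd (by
    have := congrArg Subtype.val e; rw [hφ, phi_univ_pow_apply] at this; exact this.symm)
  have n12 : φ x ≠ (φ ^ 2) x := by
    intro e
    apply n01
    have e' : φ (φ x) = φ x := by rw [← Perm.mul_apply, ← pow_two]; exact e.symm
    exact (φ.injective e').symm
  -- corner sum and card
  have hface := face_univ_eq (hX1 := hX1) (h0 := h0) x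
  unfold RotSys.excess RotSys.faceSum
  rw [hface, sum_insert (by rw [mem_insert, mem_singleton, not_or]; exact ⟨n01, n02⟩),
    sum_insert (by rw [mem_singleton]; exact n12), sum_singleton,
    card_insert_of_notMem (by rw [mem_insert, mem_singleton, not_or]; exact ⟨n01, n02⟩),
    card_insert_of_notMem (by rw [mem_singleton]; exact n12), card_singleton,
    RotSys.cornerAt_univ, RotSys.cornerAt_univ, RotSys.cornerAt_univ, hw0, hw1, hw2]
  have hli : LinearIndependent ℝ ![a, y, b] := linearIndependent_of_orient3_ne_zero hP.2.ne'
  have hex := sphExcess_nonneg hli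
  rw [sphExcess_def, angle_comm (perpTo y a) (perpTo y b)] at hex
  push_cast
  linarith

end Face

end HullRotSys

end Summit.Ventures.Crystal3D
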